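import Summits.HubbardSuperconductivity.HubbardSuperconductivity.Theorems.BalabanIRBirComplexStableXYRULEUpper
import Summits.HubbardSuperconductivity.HubbardSuperconductivity.Theorems.BalabanIRBirComplexStableXYRULELower
import Summits.HubbardSuperconductivity.HubbardSuperconductivity.Theorems.BalabanIRBirComplexStableXYRJensenTransfer
import Summits.HubbardSuperconductivity.HubbardSuperconductivity.Theorems.BalabanIRBirComplexStableXYReality
import HarnessLib

/-!
# UNIFORM LOCAL EQUIPARTITION for the modulus measure of every admissible table
# (stub `stub_uniformEquipartition` of line `log-concave-core-bounded-phase`, crux `BirComplexStableXYR`,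
# stmt-HubbardSuperconductivity-14845; line lead a2)

For every `r ≥ 2`, `B`, `c₀ > 0` there are `K₁ = 1` and `C₃ = C₃(B, c₀)` such that for every `K ≥ K₁`,
every admissible table `c` ((U1), (N), (A) `normA c ≤ B`, (C) with `c₀`), every torus
`(ℤ/L)² × ℤ/M` and every window position `s`:

  `∫ Re F(θ∘sh s) · e^{-Re A(θ)} dθ ≤ (C₃/K) · ∫ e^{-Re A(θ)} dθ`

— the expected coercive energy of a window under the POSITIVE modulus measure `e^{-Re A}dθ` is
`O(1/K)` UNIFORMLY IN THE VOLUME (the first volume-uniform non-Gaussian estimate for this crux; by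
(C) and Markov it gives a defect density `μ_R(window s is η-misaligned) ≤ C₃/(2c₀(1 − cos η)K)`
uniformly in `L, M`).

Proof (`stub_uniformEquipartition`): with `H = Σ_s Re F_s ≥ 0` and `Z(κ) = ∫ e^{-κH}`, Jensen's
inequality under `e^{-KH}dθ/Z(K)` gives `E_K[H] ≤ (2/K)·log(Z(K/2)/Z(K))` (`jensen_exp_weighted`);
`Z(K/2) ≤ 2π(√(π³/(Kc₀)))^{|Λ|−1}` (`ule_partZ_upper`) and
`Z(K) ≥ 2π(2K^{-1/2})^{|Λ|−1}e^{−3max(B,0)|Λ|}` (`ule_partZ_lower`) — the powers of `K` CANCEL — so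
`log(Z(K/2)/Z(K)) ≤ |Λ|·C''`; finally the local energy `∫ Re F_s e^{-KH}` does not depend on `s`
(translation invariance of the torus, `ule_localEnergy_translate`), hence equals `(1/|Λ|)∫ H e^{-KH}`.
Constant: `C₃ = 2(max(log(√(π³/c₀)/2), 0) + 3·max(B, 0))`.  Corollaries (the `S = Λ` tilt bound,
uniformly dilute defects) are in `…ULECorollaries`. [folklore]
-/

noncomputable section

namespace Summit.HubbardSuperconductivity.HubbardSuperconductivity.Theorems

open MeasureTheory Set

/-! ### Assembly: uniform local equipartition -/

section Assembly

open Summit.HubbardSuperconductivity.BirComplexStableXYNegative Literature.Probability.LatticeModels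

variable {r : ℕ}

/-- The real part of the action is `K` times the summed real parts of the window terms. [folklore] -/
theorem ule_action_re (K : ℝ) (c : Table r) (L M : ℕ) [NeZero L] [NeZero M] (θ : Λ L M → ℝ) :
    (action K c L M θ).re = K * ∑ s : Λ L M, (genF c (fun w => θ (sh L M s w))).re := by
  simp only [action, Complex.mul_re, Complex.ofReal_re, Complex.ofReal_im, zero_mul, sub_zero,
    Complex.re_sum]

/-- `|F(φ)| ≤ normA(c)` for every real configuration. [folklore] -/
theorem ule_norm_genF_le (c : Table r) (φ : W r → ℝ) : ‖genF c φ‖ ≤ normA c := by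
  classical
  unfold genF normA Finsupp.sum
  refine (norm_sum_le _ _).trans (Finset.sum_le_sum fun n _ => ?_)
  rw [norm_mul, mul_comm Complex.I, Complex.norm_exp_ofReal_mul_I, mul_one]
  have : (1 : ℝ) ≤ Real.exp (∑ w, |(n w : ℝ)|) :=
    Real.one_le_exp (Finset.sum_nonneg fun w _ => abs_nonneg _)
  nlinarith [norm_nonneg (c n)]

/-- Continuity of the real part of a window term in the torus field. [folklore] -/
theorem ule_continuous_re_genF_sh (c : Table r) (L M : ℕ) (s : Λ L M) :
    Continuous fun θ : Λ L M → ℝ => (genF c (fun w => θ (sh L M s w))).re := by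
  classical
  refine Complex.continuous_re.comp ?_
  unfold genF Finsupp.sum
  refine continuous_finsetSum _ fun n _ => ?_
  refine continuous_const.mul (Complex.continuous_exp.comp (continuous_const.mul ?_))
  exact Complex.continuous_ofReal.comp (continuous_finsetSum _ fun w _ =>
    continuous_const.mul (continuous_apply _))

/-- Integrability on the cube of a bounded continuous function against the modulus weight (under
(C) the weight is `≤ 1`). [folklore] -/
theorem ule_integrable_mul_weight {K c₀ : ℝ} (hK : 0 ≤ K) (hc₀ : 0 ≤ c₀) (c : Table r)
    (hC : ∀ φ : W r → ℝ, c₀ * ∑ w, ∑ w', (1 - Real.cos (φ w - φ w')) ≤ (genF c φ).re)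
    (L M : ℕ) [NeZero L] [NeZero M] (g : (Λ L M → ℝ) → ℝ) (hg : Continuous g) (Cg : ℝ)
    (hgb : ∀ θ, |g θ| ≤ Cg) :
    Integrable (fun θ => g θ * Real.exp (-(action K c L M θ).re)) (volume.restrict (cube L M)) := by
  haveI : IsFiniteMeasure ((volume : Measure (Λ L M → ℝ)).restrict (cube L M)) := by
    rw [ule_restrict_cube_eq_pi]; infer_instance
  have hre0 : ∀ θ : Λ L M → ℝ, 0 ≤ (action K c L M θ).re := by
    intro θ
    rw [ule_action_re]
    refine mul_nonneg hK (Finset.sum_nonneg fun s _ => ?_)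
    exact le_trans (mul_nonneg hc₀ (Finset.sum_nonneg fun _ _ => Finset.sum_nonneg fun _ _ =>
      sub_nonneg.2 (Real.cos_le_one _))) (hC _)
  have hcontw : Continuous fun θ : Λ L M → ℝ => Real.exp (-(action K c L M θ).re) := by
    refine Real.continuous_exp.comp (Continuous.neg ?_)
    have : (fun θ : Λ L M → ℝ => (action K c L M θ).re) =
        fun θ => K * ∑ s : Λ L M, (genF c (fun w => θ (sh L M s w))).re :=
      funext fun θ => ule_action_re K c L M θ
    rw [this]
    exact continuous_const.mul (continuous_finsetSum _ fun s _ => ule_continuous_re_genF_sh c L M s)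
  refine (integrable_const (max Cg 0)).mono' (hg.mul hcontw).aestronglyMeasurable
    (ae_of_all _ fun θ => ?_)
  rw [Real.norm_eq_abs, abs_mul, Real.abs_exp]
  have h1 : Real.exp (-(action K c L M θ).re) ≤ 1 := Real.exp_le_one_iff.mpr (by linarith [hre0 θ])
  calc |g θ| * Real.exp (-(action K c L M θ).re) ≤ Cg * 1 :=
        mul_le_mul (hgb θ) h1 (Real.exp_pos _).le ((abs_nonneg _).trans (hgb θ))
    _ ≤ max Cg 0 := by simp

/-- **Translation invariance of the local energy density.**  The modulus measure is invariant under
the translations of the torus, so `∫ Re F_{s+v}·e^{-Re A} = ∫ Re F_s·e^{-Re A}`. [folklore] -/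
theorem ule_localEnergy_translate (K : ℝ) (c : Table r) (L M : ℕ) [NeZero L] [NeZero M]
    (s v : Λ L M) :
    ∫ θ in cube L M, (genF c (fun w => θ (sh L M (s + v) w))).re * Real.exp (-(action K c L M θ).re) =
      ∫ θ in cube L M, (genF c (fun w => θ (sh L M s w))).re * Real.exp (-(action K c L M θ).re) := by
  have hsh_eq : ∀ (s : Λ L M) (w : W r), sh L M s w =
      s + (![((w.1 : ℕ) : ZMod L), ((w.2.1 : ℕ) : ZMod L)], ((w.2.2 : ℕ) : ZMod M)) := fun s w => rfl
  have hsh : ∀ (s : Λ L M) (w : W r), sh L M s w + v = sh L M (s + v) w := by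
    intro s w; rw [hsh_eq, hsh_eq, add_right_comm]
  have hact : ∀ θ : Λ L M → ℝ, action K c L M (fun l => θ (l + v)) = action K c L M θ := by
    intro θ
    unfold action
    congr 1
    simp only [hsh]
    exact Fintype.sum_equiv (Equiv.addRight v) _ _ fun s => rfl
  have key := setIntegral_cube_comp_equiv (Equiv.addRight v) 0 (2 * Real.pi)
    (fun θ : Λ L M → ℝ => (((genF c (fun w => θ (sh L M s w))).re * Real.exp (-(action K c L M θ).re) : ℝ) : ℂ))
  simp only [Equiv.coe_addRight, hsh, hact] at key
  apply Complex.ofReal_injective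
  have h1 : (((∫ θ in cube L M, (genF c (fun w => θ (sh L M (s + v) w))).re *
      Real.exp (-(action K c L M θ).re)) : ℝ) : ℂ) =
      ∫ θ in cube L M, ((((genF c (fun w => θ (sh L M (s + v) w))).re *
        Real.exp (-(action K c L M θ).re) : ℝ)) : ℂ) := (integral_ofReal).symm
  have h2 : (((∫ θ in cube L M, (genF c (fun w => θ (sh L M s w))).re *
      Real.exp (-(action K c L M θ).re)) : ℝ) : ℂ) =
      ∫ θ in cube L M, ((((genF c (fun w => θ (sh L M s w))).re *
        Real.exp (-(action K c L M θ).re) : ℝ)) : ℂ) := (integral_ofReal).symm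
  rw [h1, h2]
  exact key


/-- **UNIFORM LOCAL EQUIPARTITION (stub `stub_uniformEquipartition` of the line skeleton).**  For every
admissible table ((U1), (N), (A) `normA ≤ B`, (C) with `c₀ > 0`), every `K ≥ 1` and every torus, the
expected coercive energy of a window under the modulus measure `e^{-Re A}dθ` is `≤ C₃/K` with
`C₃ = C₃(B, c₀)` independent of `K` and of the volume:  Jensen in the coupling
(`E_K[H] ≤ (2/K)·log(Z(K/2)/Z(K))`), the sharp upper bound `ule_partZ_upper` at `K/2`, the small-ball
lower bound `ule_partZ_lower` at `K` (the powers of `K` cancel exactly), and translation invariance.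
[folklore] -/
theorem stub_uniformEquipartition :
    ∀ (r : ℕ) (B c₀ : ℝ), 2 ≤ r → 0 < c₀ → ∃ K₁ C₃ : ℝ, ∀ K : ℝ, K₁ ≤ K → ∀ c : Table r, (∀ n ∈ c.support, ∑ w, n w = 0) → c.sum (fun _ a => a) = 0 → normA c ≤ B → (∀ φ : W r → ℝ, c₀ * ∑ w, ∑ w', (1 - Real.cos (φ w - φ w')) ≤ (genF c φ).re) → ∀ (L M : ℕ) [NeZero L] [NeZero M], ∀ s : Λ L M, ∫ θ in cube L M, (genF c (fun w => θ (sh L M s w))).re * Real.exp (-(action K c L M θ).re) ≤ C₃ / K * ∫ θ in cube L M, Real.exp (-(action K c L M θ).re) := by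
  intro r B c₀ hr hc₀
  -- the constant
  set D : ℝ := Real.sqrt (Real.pi ^ 3 / c₀) / 2 with hD
  set C'' : ℝ := max (Real.log D) 0 + 3 * max B 0 with hC''
  refine ⟨1, 2 * C'', ?_⟩
  intro K hK c hU1 hN hA hC L M _ _ s₀
  classical
  have hK0 : 0 < K := by linarith
  set N : ℕ := Fintype.card (Λ L M) with hNdef
  have hN1 : 1 ≤ N := Fintype.card_pos_iff.mpr ⟨0⟩
  set H : (Λ L M → ℝ) → ℝ := fun θ => ∑ s : Λ L M, (genF c (fun w => θ (sh L M s w))).re with hH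
  set wt : (Λ L M → ℝ) → ℝ := fun θ => Real.exp (-(action K c L M θ).re) with hwt
  have hre : ∀ θ, (action K c L M θ).re = K * H θ := fun θ => ule_action_re K c L M θ
  have hC0 : ∀ φ : W r → ℝ, 0 ≤ (genF c φ).re := fun φ =>
    le_trans (mul_nonneg hc₀.le (Finset.sum_nonneg fun _ _ => Finset.sum_nonneg fun _ _ =>
      sub_nonneg.2 (Real.cos_le_one _))) (hC φ)
  have hH0 : ∀ θ, 0 ≤ H θ := fun θ => Finset.sum_nonneg fun s _ => hC0 _
  have hHb : ∀ θ, |H θ| ≤ N * normA c := by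
    intro θ
    rw [abs_of_nonneg (hH0 θ), hH]
    calc ∑ s : Λ L M, (genF c (fun w => θ (sh L M s w))).re ≤ ∑ _s : Λ L M, normA c :=
          Finset.sum_le_sum fun s _ => (Complex.re_le_norm _).trans (ule_norm_genF_le c _)
      _ = N * normA c := by rw [Finset.sum_const, Finset.card_univ, nsmul_eq_mul]
  have hcontH : Continuous H := continuous_finsetSum _ fun s _ => ule_continuous_re_genF_sh c L M s
  -- the two partition functions
  have hZup := ule_partZ_upper hr c hc₀ hC (half_pos hK0) L M
  have hZlo := ule_partZ_lower c hU1 hN hA hC0 hK L M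
  -- integrability
  have hint_w : Integrable wt (volume.restrict (cube L M)) := by
    simpa using ule_integrable_mul_weight hK0.le hc₀.le c hC L M (fun _ => (1:ℝ)) continuous_const 1
      (fun _ => by simp)
  have hint_Hw : Integrable (fun θ => (K / 2 * H θ) * wt θ) (volume.restrict (cube L M)) :=
    ule_integrable_mul_weight hK0.le hc₀.le c hC L M _ (continuous_const.mul hcontH)
      (K / 2 * (N * normA c)) (fun θ => by
        rw [abs_mul, abs_of_pos (half_pos hK0)]
        exact mul_le_mul_of_nonneg_left (hHb θ) (half_pos hK0).le)
  have hint_Fw : ∀ s, Integrable (fun θ => (genF c (fun w => θ (sh L M s w))).re * wt θ)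
      (volume.restrict (cube L M)) := fun s =>
    ule_integrable_mul_weight hK0.le hc₀.le c hC L M _ (ule_continuous_re_genF_sh c L M s) (normA c)
      (fun θ => (Complex.abs_re_le_norm _).trans (ule_norm_genF_le c _))
  -- `e^{(K/2)H}·wt` is the weight at coupling `K/2`
  have hhalf : ∀ θ, Real.exp (K / 2 * H θ) * wt θ = Real.exp (-(K / 2 * H θ)) := by
    intro θ
    simp only [hwt, hre]
    rw [← Real.exp_add]
    congr 1; ring
  have hint_ew : Integrable (fun θ => Real.exp (K / 2 * H θ) * wt θ) (volume.restrict (cube L M)) := by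
    simp_rw [hhalf]
    have := ule_integrable_mul_weight (half_pos hK0).le hc₀.le c hC L M (fun _ => (1:ℝ)) continuous_const 1
      (fun _ => by simp)
    simp only [one_mul] at this
    have hre' : ∀ θ, (action (K / 2) c L M θ).re = K / 2 * H θ := fun θ => ule_action_re (K/2) c L M θ
    simp_rw [hre'] at this
    exact this
  -- positivity of `Z(K)`
  have hZK : ∫ θ in cube L M, wt θ = ∫ θ in cube L M, Real.exp (-(K * H θ)) := by
    simp only [hwt, hre]
  have hZpos : 0 < ∫ θ in cube L M, wt θ := by
    rw [hZK]
    refine lt_of_lt_of_le ?_ hZlo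
    positivity
  -- Jensen in the coupling
  have hJ := jensen_exp_weighted (volume.restrict (cube L M)) wt (fun θ => K / 2 * H θ)
    (fun θ => (Real.exp_pos _).le) hint_w hint_Hw hint_ew hZpos
  -- the two integrals and their ratio
  set Z : ℝ := ∫ θ in cube L M, wt θ with hZ
  set Zh : ℝ := ∫ θ in cube L M, Real.exp (K / 2 * H θ) * wt θ with hZh
  have hratio_pos : 0 < Zh / Z := lt_of_lt_of_le (Real.exp_pos _) hJ
  -- `Zh ≤ D^{N-1} e^{3 B⁺ N} · Z`
  have hDpos : 0 < D := by rw [hD]; positivity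
  have hA_eq : Real.sqrt (Real.pi ^ 3 / (2 * (K / 2 * c₀))) = D * (2 * (Real.sqrt K)⁻¹) := by
    rw [hD]
    have hKc : 2 * (K / 2 * c₀) = K * c₀ := by ring
    rw [hKc, show Real.pi ^ 3 / (K * c₀) = (Real.pi ^ 3 / c₀) / K by field_simp,
      Real.sqrt_div' _ hK0.le]
    have hsK : 0 < Real.sqrt K := Real.sqrt_pos.mpr hK0
    field_simp
  have hZh_le : Zh ≤ D ^ (N - 1) * Real.exp (3 * max B 0 * N) * Z := by
    have h1 : Zh ≤ 2 * Real.pi * (D * (2 * (Real.sqrt K)⁻¹)) ^ (N - 1) := by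
      rw [hZh]; simp_rw [hhalf]; rw [← hA_eq]; exact hZup
    have h2 : 2 * Real.pi * (D * (2 * (Real.sqrt K)⁻¹)) ^ (N - 1) =
        D ^ (N - 1) * Real.exp (3 * max B 0 * N) *
          (2 * Real.pi * (2 * (Real.sqrt K)⁻¹) ^ (N - 1) * Real.exp (-(3 * max B 0 * N))) := by
      rw [mul_pow, Real.exp_neg]
      have : Real.exp (3 * max B 0 * N) ≠ 0 := (Real.exp_pos _).ne'
      field_simp
    have h3 : 2 * Real.pi * (2 * (Real.sqrt K)⁻¹) ^ (N - 1) * Real.exp (-(3 * max B 0 * N)) ≤ Z := by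
      have e : Z = ∫ θ in cube L M, Real.exp (-(K * H θ)) := hZK
      rw [e]; exact hZlo
    calc Zh ≤ _ := h1
      _ = _ := h2
      _ ≤ D ^ (N - 1) * Real.exp (3 * max B 0 * N) * Z := by
          have : 0 ≤ D ^ (N - 1) * Real.exp (3 * max B 0 * N) := by positivity
          exact mul_le_mul_of_nonneg_left h3 this
  have hlog : Real.log (Zh / Z) ≤ N * C'' := by
    have h1 : Zh / Z ≤ D ^ (N - 1) * Real.exp (3 * max B 0 * N) := by
      rw [div_le_iff₀ hZpos]; exact hZh_le
    have h2 : Real.log (Zh / Z) ≤ Real.log (D ^ (N - 1) * Real.exp (3 * max B 0 * N)) :=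
      Real.log_le_log hratio_pos h1
    have h3 : Real.log (D ^ (N - 1) * Real.exp (3 * max B 0 * N)) =
        (N - 1 : ℕ) * Real.log D + 3 * max B 0 * N := by
      rw [Real.log_mul (pow_ne_zero _ hDpos.ne') (Real.exp_pos _).ne', Real.log_pow, Real.log_exp]
    rw [h3] at h2
    have hN1' : ((N - 1 : ℕ) : ℝ) = (N : ℝ) - 1 := by
      rw [Nat.cast_sub hN1]; simp
    rw [hN1'] at h2
    have hlD : Real.log D ≤ max (Real.log D) 0 := le_max_left _ _
    have hm0 : 0 ≤ max (Real.log D) 0 := le_max_right _ _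
    have hNr : (1 : ℝ) ≤ N := by exact_mod_cast hN1
    rw [hC'']
    nlinarith [hlD, hm0, hNr, h2]
  -- Jensen ⇒ `∫ (K/2)H·wt ≤ N C'' Z`
  have hJ2 : (∫ θ in cube L M, (K / 2 * H θ) * wt θ) / Z ≤ N * C'' := by
    have := (Real.le_log_iff_exp_le hratio_pos).mpr hJ
    exact this.trans hlog
  have hHw : ∫ θ in cube L M, H θ * wt θ ≤ 2 / K * (N * C'') * Z := by
    have h1 : ∫ θ in cube L M, (K / 2 * H θ) * wt θ ≤ N * C'' * Z := (div_le_iff₀ hZpos).mp hJ2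
    have h2 : ∫ θ in cube L M, (K / 2 * H θ) * wt θ = K / 2 * ∫ θ in cube L M, H θ * wt θ := by
      rw [← integral_const_mul]
      congr 1; funext θ; ring
    rw [h2] at h1
    have hK2 : 0 < K / 2 := half_pos hK0
    calc ∫ θ in cube L M, H θ * wt θ = 2 / K * (K / 2 * ∫ θ in cube L M, H θ * wt θ) := by
          field_simp
      _ ≤ 2 / K * (N * C'' * Z) := mul_le_mul_of_nonneg_left h1 (by positivity)
      _ = 2 / K * (N * C'') * Z := by ring
  -- translation invariance ⇒ the local energy is the average
  have htrans : ∀ s : Λ L M, ∫ θ in cube L M, (genF c (fun w => θ (sh L M s w))).re * wt θ =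
      ∫ θ in cube L M, (genF c (fun w => θ (sh L M s₀ w))).re * wt θ := by
    intro s
    have := ule_localEnergy_translate K c L M s₀ (s - s₀)
    rw [add_sub_cancel] at this
    simpa only [hwt] using this
  have hsum : ∑ s : Λ L M, ∫ θ in cube L M, (genF c (fun w => θ (sh L M s w))).re * wt θ =
      ∫ θ in cube L M, H θ * wt θ := by
    rw [← integral_finsetSum _ (fun s _ => hint_Fw s)]
    congr 1; funext θ
    rw [hH, Finset.sum_mul]
  have havg : (N : ℝ) * ∫ θ in cube L M, (genF c (fun w => θ (sh L M s₀ w))).re * wt θ =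
      ∫ θ in cube L M, H θ * wt θ := by
    rw [← hsum, Finset.sum_congr rfl fun s _ => htrans s, Finset.sum_const, Finset.card_univ,
      nsmul_eq_mul]
  -- conclude
  have hNpos : (0 : ℝ) < N := by exact_mod_cast hN1
  have hfinal : ∫ θ in cube L M, (genF c (fun w => θ (sh L M s₀ w))).re * wt θ ≤ 2 * C'' / K * Z := by
    have h1 : (N : ℝ) * ∫ θ in cube L M, (genF c (fun w => θ (sh L M s₀ w))).re * wt θ ≤
        (N : ℝ) * (2 * C'' / K * Z) := by
      rw [havg]
      calc ∫ θ in cube L M, H θ * wt θ ≤ 2 / K * (N * C'') * Z := hHw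
        _ = (N : ℝ) * (2 * C'' / K * Z) := by ring
    exact le_of_mul_le_mul_left h1 hNpos
  simpa only [hwt, hZ] using hfinal



end Assembly

end Summit.HubbardSuperconductivity.HubbardSuperconductivity.Theorems

end
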